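import Summits.BirchSwinnertonDyer.Rank1Residual.Additive.RamifiedSevenGenusKatoPinnedFrame
import Summits.BirchSwinnertonDyer.Rank1Residual.Additive.KatoDescentIntegralH1RankOne
import Summits.BirchSwinnertonDyer.Rank1Residual.X12.CMInertTrace
import Summits.BirchSwinnertonDyer.Rank1Residual.AdditivePotMult.TwistPointsOver
import Literature.NumberTheory.EllipticCurves.Kato2004.IwasawaCohomologyNumberFieldTwistSum
import Literature.NumberTheory.EllipticCurves.Kato2004.IwasawaH1LambdaTorsionFreeProofs
import Literature.NumberTheory.EllipticCurves.Kato2004.IwasawaH1RankLeOneProofs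
import Literature.NumberTheory.EllipticCurves.Kato2004.IwasawaCohomologyExistsProofs
import Literature.NumberTheory.EllipticCurves.TateModuleQuadraticTwistEquivProofs
import Literature.NumberTheory.EllipticCurves.ComplexMultiplicationTwistIsogenyCertProofs
import Literature.NumberTheory.EllipticCurves.ComplexMultiplicationLFunctionIsogenyHoldsProofs
import Literature.NumberTheory.EllipticCurves.IsogenyQuadraticTwistProofs
import Literature.NumberTheory.EllipticCurves.QuadraticBaseChangeGaloisProofs
import Literature.NumberTheory.EllipticCurves.SelmerPInftyRelModelAction
import Literature.NumberTheory.EllipticCurves.GlobalMinimalModelProofs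
import Mathlib.LinearAlgebra.Dimension.Localization
import Mathlib.LinearAlgebra.Dimension.RankNullity
import HarnessLib

set_option autoImplicit false

/-!
# `𝒞₇` genus road (crux `EllipticUnitValueSevenOfGZK`, K7r), row (K2C-3) block (T): the ALGEBRAIC BINDERS (tf) and (rk) of
# the registered K2ᶜ input form `stub_integralComparisonInputsSeven` (zp v13) are THEOREMS at every pinned frame —
# (tf) unconditionally, (rk) from the stub's own antecedent GZK on `𝒞₇` — by Shapiro's lemma `K/ℚ` for the CM field

Cell bsd-cm, seat bsd-cm-prr-ty1 g31 (literature-prover), SUMMON `wake/SUMMON-bsd-cm-prr-ty1-20260830T1838Z.md` (planner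
bsd-cm-plan g36, D927; key K2C-3), block (T) `PinnedKatoGenusFrame.tf_of_inputs` / `.rk_of_inputs`.  HONEST LABEL: THEOREMS
ONLY (no definition, no named fact, no `sorry`, no instance, no notation); the two conjuncts are discharged at every
`Φ : PinnedKatoGenusFrame W K hK I d` — (tf) given only a topological generator `γ` of the cyclotomic datum, (rk) given
GZK (`rank_eq_analyticRank_of_analyticRank_le_one`) and `W ∈ 𝒞₇`; by D903 (3)/D914 such input discharges are CONSUMED
INSIDE the eventual proof of the stub (no re-lettering); the stub `stub_integralComparisonInputsSeven` itself (its
existential prefix (E1∃)/(R3∃), (hL), (r5′), (KI)) is NOT proved here; stmt-BirchSwinnertonDyer-19945 is OPEN;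
`X12.CMRamifiedSeven` is NOT proved; no summit statement is proved by this seat; BSD is claimed for no curve.

## The two binders (zp v13 `dc78fcfefa3e951e`, l.510–513, VERBATIM) and what they say

For `Φ : PinnedKatoGenusFrame W K hK I d` the field `Φ.IK : IwasawaH1DataOver (W.baseChange Φ.Kcm) 7 (K.restrictOfFinrankEqTwo
_ Φ.Kcm _) Φ.γK` is the tree's RIGID pin of the `K`-side Iwasawa cohomology `H¹_Iw(Kℚ_∞/K, T₇W) = lim← H¹(O_{Kℚ_n}[1/7], T₇W)`
(`(proj n)_n` jointly bijective), Kato's `𝐇′(S′_W)` by Shapiro (15.14); `Φ.piK` is the CM operator `√−7` on it.  The stub asks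
* (tf) `∀ (f : IwasawaAlgebra 7) (x : Φ.IK.H), f ≠ 0 → f • x = 0 → x = 0` — `𝐇′(S′_W)` is `Λ`-torsion free (hence
  `Λ_O`-torsion free: Kato Thm. 12.4 (2) «`𝐇¹(T)` is a torsion free `Λ`-module», p. 221, for the split hull);
* (rk) `∀ x y : Φ.IK.H, ∃ s r₀ r₁ : IwasawaAlgebra 7, (s ≠ 0 ∨ r₀ ≠ 0 ∨ r₁ ≠ 0) ∧ s • x = r₀ • y + r₁ • Φ.piK y` — any `x` is
  `Λ`-dependent on `{y, πy}`, i.e. `rank_{Λ_O} 𝐇′(S′_W) ≤ 1` (Thm. 12.4 (2) «`𝐇¹(T) ⊗ ℚ` … is a free `Λ ⊗ ℚ`-module of rank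
  `1`» read at the split hull `S′_W = T₇W ⊗ ℤ₇[Gal(K/ℚ)]`, i.e. `rank_Λ ≤ 2`).

## The proof (Shapiro's lemma for the quadratic CM field, tree vocabulary of cell bsd-2adic; numbers, not adjectives)

Let `K = Φ.Kcm = ℚ(√−7)` (`[K:ℚ] = 2`, so `K/ℚ` is Galois and `galRange K ⊴ Γ_ℚ`; `κ ∘ res_{K/ℚ}` is onto for the cyclotomic
`ℤ₇`-extension, `surjective_comp_absGaloisRestrict_of_finrank_eq_two`, and the frame's tower IS `K.restrict Φ.Kcm _` by
definition of `restrictOfFinrankEqTwo`).  Let `A` be a globally minimal model of the quadratic twist `W^{(−7)}` and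
`u : T₇A ≃ T₇W` the twist isomorphism, `galRange K`-equivariant and anti-equivariant off it
(`WeierstrassCurve.exists_tateModule_equiv_of_smul_eq_quadraticTwist`, Silverman X.5.4; `σ ∈ galRange K ↔ σ√−7 = √−7`,
§1).  With the ℚ-side pins `I` (the frame's) and `I_A` (any, `nonempty_iwasawaH1Data_holds`) the tree has the Shapiro maps
`cor : Φ.IK.H → I.H`, `cor^A : Φ.IK.H → I_A.H`, `res`, `res^A`, all `Λ`-linear, and the SUM IDENTITY
`res (cor x) + res^A (cor^A x) = 2 • x` (`IwasawaH1DataOver.resOver_corOver_add_resOverTwist_corOverTwist`, Greenberg LNM 1716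
§4 p. 107 / NSW I §5 (1.5.6)–(1.5.7)).
* (tf) §3: `f • x = 0` gives `f • cor x = 0`, `f • cor^A x = 0`, so `cor x = 0 = cor^A x` by the ℚ-side THEOREM
  `IwasawaH1Data.eq_zero_of_smul_eq_zero` (Kato Thm. 12.4 (2) first half, PROVED in `IwasawaH1LambdaTorsionFreeProofs` for
  every `E/ℚ`, `p`, generator), whence `2 • x = 0` and `x = 0` (`2 ∈ ℤ₇ˣ` acts through `proj_C_smul`).  No input beyond `hγ`.
* (rk) §4: `(cor, cor^A) : Φ.IK.H → I.H × I_A.H` is injective by the same identity, so `rank_Λ Φ.IK.H ≤ rank_Λ I.H + rank_Λ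
  I_A.H` (rank–nullity over the domain `Λ = ℤ₇⟦X⟧`); each summand is `≤ 1` by the tree's (R2)
  `IwasawaH1Data.rank_le_one_of_rank_integralH1_le_one` on top of (R1) `LocPKummer.rank_integralH1_le_one` (Mordell–Weil rank
  `1` and `Ш[7^∞]` finite), which GZK supplies for `W` (`W ∈ 𝒞₇`: analytic rank `1`) AND for `A`, because `A` is
  `ℚ`-ISOGENOUS to `W`: `W ~ W′` with `j(W′) ∈ {−3375}` maximal of the same CM field (`X12.exists_isIsogenous_maximal_cmFieldDiscr_eq`,
  the tree's `16581375 ~ −3375`), `W′ ~ W′^{(−7)}` (Milne 1972 Thm. 3 = `isIsogenous_quadraticTwist_cmFieldDiscr_holds`, PROVED),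
  twisting commutes with isogeny (`IsIsogenous.quadraticTwist`, Cremona §3.9) and `ℚ`-isogenous curves have the same analytic
  rank (`analyticRank_eq_of_isIsogenous'`, Knapp Thm. 11.67); so `analyticRank A = 1` and GZK applies to `A`.  Then three
  elements `x, y, Φ.piK y` of a module of rank `≤ 2` over a domain are dependent (`LinearIndependent.cardinal_le_rank`), which is
  (rk) letter for letter.  ★ (`exists_zetaClassPosition_of_rank_le_one`) is not used; no `thm12_4` hypothesis is used.

References: §0 algebra; §1 the field `Φ.Kcm`; §2 the twist pair; §3 ★ `tf_of_inputs`; §4 `rk_of_rank_le_one`, ★ `rk_of_inputs`,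
`tf_and_rk_of_inputs`.  K. Kato, Astérisque 295 (2004) Thm. 12.4 (2) (p. 221), 15.14 (p. 264) [Kato2004Asterisque]; R. Greenberg,
LNM 1716 (1999) §4 p. 107 [GreenbergLNM1716]; Neukirch–Schmidt–Wingberg (2008) I §5–§6 [NeukirchSchmidtWingberg2008]; J. S. Milne,
Invent. Math. 17 (1972) Thm. 3 [Milne1972ArithmeticAV]; J. E. Cremona, *Algorithms* (1997) §3.9 [CremonaAlgorithms1997]; A. W. Knapp
(1992) Thm. 11.67 [Knapp1993]; J. H. Silverman, *AEC* (2009) X.5 Cor. 5.4 [SilvermanAEC2009]; H. Darmon, CBMS 101 (2004) Thm. 3.22 [Darmon2004].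
-/

noncomputable section

open scoped NumberField
open Field NumberField WeierstrassCurve
open Literature.NumberTheory.GaloisRepresentations
open Literature.NumberTheory.EllipticCurves
open Literature.NumberTheory.EllipticCurves.Rank1Residual
open Literature.NumberTheory.EllipticCurves.IwasawaAlgebra
open Literature.NumberTheory.EllipticCurves.Kato2004
open Literature.NumberTheory.EllipticCurves.Kato2004.EulerSystemValues
open Literature.NumberTheory.ComplexMultiplication.EllipticUnits
open Summit.BirchSwinnertonDyer.Rank1Residual
open Summit.BirchSwinnertonDyer.Rank1Residual.AdditivePotMult

namespace Summit.BirchSwinnertonDyer.Rank1Residual.Additive.GenusSeven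

/-! ## §0 Module algebra over a domain; `2 ∈ ℤ_pˣ` -/

namespace KSideRank

section Algebra

variable {R : Type} [CommRing R] [IsDomain R] {M N₁ N₂ : Type} [AddCommGroup M] [Module R M]
  [AddCommGroup N₁] [Module R N₁] [AddCommGroup N₂] [Module R N₂]

/-- `rank (N₁ × N₂) = rank N₁ + rank N₂` over a domain (rank–nullity for the first projection). [folklore] -/
theorem rank_prod_eq_add : Module.rank R (N₁ × N₂) = Module.rank R N₁ + Module.rank R N₂ := by
  have h := LinearMap.rank_eq_of_surjective (f := LinearMap.fst R N₁ N₂) Prod.fst_surjective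
  rw [h, LinearMap.ker_fst, ← (LinearEquiv.ofInjective _ LinearMap.inr_injective).rank_eq]

/-- **The algebraic core of (rk).**  If `M` maps to two modules of rank `≤ 1` by linear maps with jointly trivial kernel,
then `rank M ≤ 2` and any three elements `x, y, z ∈ M` satisfy a non-trivial relation `s • x = r₀ • y + r₁ • z`
(over a domain, `LinearIndependent.cardinal_le_rank`). [folklore] -/
theorem exists_rel_of_rank_le_one (f₁ : M →ₗ[R] N₁) (f₂ : M →ₗ[R] N₂)
    (hinj : ∀ x, f₁ x = 0 → f₂ x = 0 → x = 0)
    (h₁ : Module.rank R N₁ ≤ 1) (h₂ : Module.rank R N₂ ≤ 1) (x y z : M) :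
    ∃ s r₀ r₁ : R, (s ≠ 0 ∨ r₀ ≠ 0 ∨ r₁ ≠ 0) ∧ s • x = r₀ • y + r₁ • z := by
  have hf : Function.Injective (f₁.prod f₂) := by
    refine (injective_iff_map_eq_zero _).mpr fun a ha => ?_
    exact hinj a (congrArg Prod.fst ha) (congrArg Prod.snd ha)
  have hrank : Module.rank R M ≤ 2 := by
    calc Module.rank R M ≤ Module.rank R (N₁ × N₂) := LinearMap.rank_le_of_injective _ hf
      _ = Module.rank R N₁ + Module.rank R N₂ := rank_prod_eq_add
      _ ≤ 1 + 1 := add_le_add h₁ h₂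
      _ = 2 := by norm_num
  have hdep : ¬ LinearIndependent R ![x, y, z] := by
    intro hv
    have h3 : (3 : Cardinal) ≤ Module.rank R M := by simpa using hv.cardinal_le_rank
    have : (3 : Cardinal) ≤ 2 := h3.trans hrank
    norm_num at this
  obtain ⟨g, hg, i, hi⟩ := Fintype.not_linearIndependent_iff.mp hdep
  refine ⟨g 0, -g 1, -g 2, ?_, ?_⟩
  · fin_cases i
    · exact Or.inl hi
    · exact Or.inr (Or.inl (neg_ne_zero.mpr hi))
    · exact Or.inr (Or.inr (neg_ne_zero.mpr hi))
  · simp only [Fin.sum_univ_three, Matrix.cons_val_zero, Matrix.cons_val_one,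
      Matrix.cons_val_two, Matrix.tail_cons, Matrix.head_cons] at hg
    rw [neg_smul, neg_smul, ← neg_add, eq_neg_iff_add_eq_zero, ← add_assoc, hg]

end Algebra

section Two

variable {p : ℕ} [Fact p.Prime]

/-- **No `2`-torsion on `𝐇¹_{K,Γ}(T_pV)` for `p ≠ 2`**: `2 • x = 0 → x = 0` — `2 ∈ ℤ_pˣ` (the tree's
`WeierstrassCurve.isUnit_two_padicInt`, restated inline to keep the imports light) maps to a unit of `Λ`.
[cite: Kato2004Asterisque, §12.2 (p. 220)] -/
theorem eq_zero_of_two_nsmul_eq_zero (hp : p ≠ 2) {L : Type} [Field L] {V : WeierstrassCurve L}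
    [ContinuousSMul ℤ_[p] (V.tateModule p)] {κ : ZpExtension L p} {γ : absoluteGaloisGroup L}
    (IK : IwasawaH1DataOver V p κ γ) {x : IK.H} (hx : (2 : ℕ) • x = 0) : x = 0 := by
  have hu : IsUnit (2 : ℤ_[p]) := by
    rw [PadicInt.isUnit_iff, show (2 : ℤ_[p]) = ((2 : ℕ) : ℤ_[p]) by norm_cast, PadicInt.norm_natCast_eq_one_iff]
    exact (Nat.coprime_primes Fact.out Nat.prime_two).mpr hp
  have hu' : IsUnit (2 : IwasawaAlgebra p) := by
    have h := hu.map (PowerSeries.C (R := ℤ_[p]))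
    rwa [map_ofNat] at h
  have h2 : (2 : IwasawaAlgebra p) • x = (2 : ℕ) • x := by
    rw [← Nat.cast_smul_eq_nsmul (IwasawaAlgebra p) 2 x, Nat.cast_ofNat]
  have h : (2 : IwasawaAlgebra p) • x = (2 : IwasawaAlgebra p) • (0 : IK.H) := by rw [h2, hx, smul_zero]
  exact hu'.smul_left_cancel.mp h

end Two

end KSideRank

/-! ## §1 The quadratic CM field of the frame: `K/ℚ` Galois, `galRange K` normal, `galRange K = Stab(√−7)` -/

section Frame

variable {W : WeierstrassCurve ℚ} [W.IsElliptic] [W.IsGloballyMinimal] [Fact (Nat.Prime 7)]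
  [ContinuousSMul ℤ_[7] (W.tateModule 7)] {K : ZpExtension ℚ 7} {hK : K.IsCyclotomic}
  {γ : Field.absoluteGaloisGroup ℚ} {I : IwasawaH1Data W 7 K γ}
  {F : GenusFrame} {θu : ∀ n : ℕ, globalUnitsOf (F.layer n)} {d : GenusDatum F θu}

namespace PinnedKatoGenusFrame

variable (Φ : PinnedKatoGenusFrame W K hK I d)

/-- `√−7 ∉ ℚ` inside `Φ.Kcm` (a rational square is non-negative). [folklore] -/
theorem sqrtNegSeven_not_mem_range : Φ.sqrtNegSeven ∉ Set.range (algebraMap ℚ Φ.Kcm) := by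
  rintro ⟨q, hq⟩
  have h1 : algebraMap ℚ Φ.Kcm (q ^ 2) = algebraMap ℚ Φ.Kcm (-7) := by
    rw [map_pow, hq, Φ.sqrtNegSeven_sq, map_neg, map_ofNat]
  have h2 : q ^ 2 = -7 := (algebraMap ℚ Φ.Kcm).injective h1
  nlinarith [sq_nonneg q]

/-- `(√−7)² = −7` read through `algebraMap ℚ`. [folklore] -/
theorem sqrtNegSeven_sq' : Φ.sqrtNegSeven ^ 2 = algebraMap ℚ Φ.Kcm (-7) := by
  rw [Φ.sqrtNegSeven_sq, map_neg, map_ofNat]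

/-- `K = Φ.Kcm` is Galois over `ℚ` (quadratic). [folklore] -/
theorem isGalois_Kcm : IsGalois ℚ Φ.Kcm := isGalois_of_finrank_eq_two Φ.Kcm Φ.finrank_Kcm

/-- `galRange K ⊴ Γ_ℚ` for the quadratic CM field (`RelModel.normal_galRange`). [cite: NeukirchSchmidtWingberg2008, I §5] -/
theorem normal_galRange_Kcm : (galRange (K := ℚ) Φ.Kcm).Normal :=
  haveI := Φ.isGalois_Kcm
  RelModel.normal_galRange (K := ℚ) Φ.Kcm

/-- **`σ ∈ Gal(ℚ̄/K)` iff `σ√−7 = √−7`** for `K = Φ.Kcm = ℚ(√−7)` (the image of `Φ.sqrtNegSeven` in `ℚ̄` is `±√−7`;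
sign rules `apply_rootInClosure_of_(not_)mem`). [folklore] -/
theorem mem_galRange_iff_smul_geomSqrt (σ : absoluteGaloisGroup ℚ) :
    σ ∈ galRange (K := ℚ) Φ.Kcm ↔ σ • geomSqrt (-7 : ℚ) = geomSqrt (-7 : ℚ) := by
  have hθK := Φ.sqrtNegSeven_not_mem_range
  have hθ := Φ.sqrtNegSeven_sq'
  have hsq : rootInClosure Φ.Kcm Φ.sqrtNegSeven ^ 2 = geomSqrt (-7 : ℚ) ^ 2 := by
    rw [rootInClosure_sq Φ.Kcm hθ, geomSqrt_sq]; simp only [eq_ratCast]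
  constructor
  · intro hσ
    have h1 : σ • rootInClosure Φ.Kcm Φ.sqrtNegSeven = rootInClosure Φ.Kcm Φ.sqrtNegSeven :=
      apply_rootInClosure_of_mem Φ.Kcm hσ
    rcases sq_eq_sq_iff_eq_or_eq_neg.mp hsq with h | h
    · rwa [h] at h1
    · rw [h, smul_neg, neg_inj] at h1
      exact h1
  · intro hσ
    by_contra hn
    have h1 : σ • rootInClosure Φ.Kcm Φ.sqrtNegSeven = -rootInClosure Φ.Kcm Φ.sqrtNegSeven :=
      apply_rootInClosure_of_not_mem Φ.Kcm Φ.finrank_Kcm hθK hθ hn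
    rcases sq_eq_sq_iff_eq_or_eq_neg.mp hsq with h | h
    · rw [h, hσ] at h1
      exact geomSqrt_ne_neg (by norm_num : (-7 : ℚ) ≠ 0) h1
    · rw [h, smul_neg, hσ, neg_neg] at h1
      exact geomSqrt_ne_neg (by norm_num : (-7 : ℚ) ≠ 0) h1.symm

/-- `κ ∘ res_{K/ℚ}` is onto for the frame's cyclotomic `ℤ₇`-extension (`[K:ℚ] = 2`, `7 ≠ 2`); the frame's tower
`K.restrictOfFinrankEqTwo _ Φ.Kcm _` is `K.restrict Φ.Kcm` of this. [cite: Washington1997, §13.1] -/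
theorem surjective_restrict :
    Function.Surjective (K.toContinuousMonoidHom.comp (absGaloisRestrict ℚ Φ.Kcm)) :=
  ZpExtension.surjective_comp_absGaloisRestrict_of_finrank_eq_two (by decide) K Φ.Kcm Φ.finrank_Kcm

/-! ## §2 The twist pair of a member: a globally minimal model `A` of `W^{(−7)}`, `u : T₇A ≃ T₇W`, and `A ~ W` -/

/-- **The twist pair.**  There is a globally minimal model `A` of the quadratic twist `W^{(−7)}` (`C • A = W^{(−7)}`) with a
continuous `ℤ₇`-linear `u : T₇A ≃ T₇W` (continuous inverse), `galRange K`-equivariant and anti-equivariant off `galRange K`,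
`K = Φ.Kcm`. [cite: SilvermanAEC2009, X.5 Cor. 5.4 and VIII.8 Cor. 8.3] -/
theorem exists_twistPair :
    ∃ (A : WeierstrassCurve ℚ) (_ : A.IsElliptic) (_ : A.IsGloballyMinimal) (C : VariableChange ℚ),
      C • A = W.quadraticTwist (-7 : ℚ) ∧
      ∃ u : A.tateModule 7 ≃ₗ[ℤ_[7]] W.tateModule 7, Continuous u ∧ Continuous u.symm ∧
        (∀ σ : absoluteGaloisGroup ℚ, σ ∈ galRange (K := ℚ) Φ.Kcm → ∀ x : A.tateModule 7, u (σ • x) = σ • u x) ∧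
        (∀ σ : absoluteGaloisGroup ℚ, σ ∉ galRange (K := ℚ) Φ.Kcm → ∀ x : A.tateModule 7, u (σ • x) = -(σ • u x)) := by
  have hd : (-7 : ℚ) ≠ 0 := by norm_num
  haveI := W.isElliptic_quadraticTwist hd
  obtain ⟨C, hC⟩ := hasGlobalMinimalModel_rat_holds (W.quadraticTwist (-7 : ℚ))
  haveI : (C • W.quadraticTwist (-7 : ℚ)).IsGloballyMinimal := hC
  have hA : C⁻¹ • (C • W.quadraticTwist (-7 : ℚ)) = W.quadraticTwist (-7 : ℚ) := inv_smul_smul C _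
  obtain ⟨u, hc, hc', h₁, h₂⟩ :=
    W.exists_tateModule_equiv_of_smul_eq_quadraticTwist (C • W.quadraticTwist (-7 : ℚ)) C⁻¹ hd hA 7
  refine ⟨C • W.quadraticTwist (-7 : ℚ), inferInstance, hC, C⁻¹, hA, u, hc, hc', fun σ hσ => h₁ σ
    ((Φ.mem_galRange_iff_smul_geomSqrt σ).mp hσ), fun σ hσ => h₂ σ ?_⟩
  rcases map_geomSqrt (absoluteGaloisGroup.toAlgEquiv ℚ σ) (-7 : ℚ) with h | h
  · exact absurd ((Φ.mem_galRange_iff_smul_geomSqrt σ).mpr h) hσ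
  · exact h

omit [W.IsGloballyMinimal] [Fact (Nat.Prime 7)] [ContinuousSMul ℤ_[7] (W.tateModule 7)] in
/-- **A member of `𝒞₇` is `ℚ`-isogenous to its twist by `−7`** (more generally: any `W/ℚ` with CM field `ℚ(√−7)`):
`W ~ W′` with `j(W′)` maximal of CM field discriminant `−7` (`X12.exists_isIsogenous_maximal_cmFieldDiscr_eq`),
`W′ ~ W′^{(−7)}` (Milne 1972, Thm. 3; tree `isIsogenous_quadraticTwist_cmFieldDiscr_holds`), and twisting commutes with
isogenies (`IsIsogenous.quadraticTwist`); we record the two legs `W ~ W′^{(−7)}` and `W^{(−7)} ~ W′^{(−7)}`.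
[cite: Milne1972ArithmeticAV, Thm. 3 (through BurungaleFlach2024)] [cite: CremonaAlgorithms1997, §3.9 (p. 87)] -/
theorem exists_isIsogenous_twist (hcm : cmFieldDiscrOfJ W.j = -7) :
    ∃ (W' : WeierstrassCurve ℚ) (_ : W'.IsElliptic),
      IsIsogenous W (W'.quadraticTwist (-7 : ℚ)) ∧ IsIsogenous (W.quadraticTwist (-7 : ℚ)) (W'.quadraticTwist (-7 : ℚ)) := by
  have hj : W.j ∈ cmJInvariants := X12.mem_cmJInvariants_of_cmFieldDiscrOfJ_ne_zero (by rw [hcm]; norm_num)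
  obtain ⟨W', hW', hiso, hmax, hdisc⟩ := X12.exists_isIsogenous_maximal_cmFieldDiscr_eq W hj
  have h2 : IsIsogenous W' (W'.quadraticTwist (cmFieldDiscr W'.j : ℚ)) :=
    isIsogenous_quadraticTwist_cmFieldDiscr_holds W' hmax
  rw [hdisc, hcm] at h2
  push_cast at h2
  exact ⟨W', hW', hiso.trans' h2, hiso.quadraticTwist (by norm_num)⟩

omit [W.IsGloballyMinimal] [Fact (Nat.Prime 7)] [ContinuousSMul ℤ_[7] (W.tateModule 7)] in
/-- **Any model `A` of `W^{(−7)}` has the analytic rank of `W`** when `W` has CM field `ℚ(√−7)` (`ℚ`-isogenous curves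
have the same analytic rank, Knapp Thm. 11.67 = `analyticRank_eq_of_isIsogenous'`, PROVED in the tree).
[cite: Knapp1993, Thm. 11.67 (PDF p. 281)] [cite: Milne1972ArithmeticAV, Thm. 3 (through BurungaleFlach2024)] -/
theorem analyticRank_twistModel_eq (hcm : cmFieldDiscrOfJ W.j = -7) (A : WeierstrassCurve ℚ) [A.IsElliptic]
    (C : VariableChange ℚ) (hA : C • A = W.quadraticTwist (-7 : ℚ)) : A.analyticRank = W.analyticRank := by
  haveI := W.isElliptic_quadraticTwist (d := (-7 : ℚ)) (by norm_num)
  obtain ⟨W', hW', h1, h2⟩ := exists_isIsogenous_twist hcm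
  haveI := W'.isElliptic_quadraticTwist (d := (-7 : ℚ)) (by norm_num)
  have h3 : IsIsogenous A (W.quadraticTwist (-7 : ℚ)) := by rw [← hA]; exact isIsogenous_smul A C
  rw [analyticRank_eq_of_isIsogenous' h3, analyticRank_eq_of_isIsogenous' h2, ← analyticRank_eq_of_isIsogenous' h1]

/-! ## §3 (tf): `𝐇′(S′_W) = Φ.IK.H` is `Λ`-torsion free — UNCONDITIONALLY at every pinned frame -/

/-- **★ (tf) — the binder (tf) of `stub_integralComparisonInputsSeven` is a THEOREM at every pinned frame**: for a
topological generator `γ` of the cyclotomic datum, `Φ.IK.H = H¹_Iw(Kℚ_∞/K, T₇W)` is a TORSION-FREE `Λ`-module —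
`f ≠ 0`, `f • x = 0 ⇒ x = 0`.  Shapiro: `cor x ∈ 𝐇¹_Γ(T₇W)` and `cor^A x ∈ 𝐇¹_Γ(T₇A)` are killed by `f`, hence vanish by
the ℚ-side theorem `IwasawaH1Data.eq_zero_of_smul_eq_zero` (Kato Thm. 12.4 (2), first half, PROVED for every `E/ℚ`);
then `2 • x = res (cor x) + res^A (cor^A x) = 0` and `2 ∈ Λˣ`.  No print input, no fact.
[cite: Kato2004Asterisque, Thm. 12.4 (2) (p. 221) and 15.14 (p. 264)] [cite: GreenbergLNM1716, §4 p. 107]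
[cite: NeukirchSchmidtWingberg2008, I §5 (1.5.6)–(1.5.7) and I §6] -/
theorem tf_of_inputs (hγ : K.IsTopGenerator γ) :
    ∀ (f : IwasawaAlgebra 7) (x : Φ.IK.H), f ≠ 0 → f • x = 0 → x = 0 := by
  intro f x hf hfx
  haveI : (galRange (K := ℚ) Φ.Kcm).Normal := Φ.normal_galRange_Kcm
  obtain ⟨A, hAell, _, C, _, u, hu, hu', hu₁, hu₂⟩ := Φ.exists_twistPair
  letI : ContinuousSMul ℤ_[7] (A.tateModule 7) := TateModule.continuousSMul_padicInt
  obtain ⟨I_A⟩ := nonempty_iwasawaH1Data_holds A 7 K γ hK hγ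
  -- the two corestrictions of `x` are `Λ`-torsion, hence zero on the ℚ-side pins
  have hcor : Φ.IK.corOver I Φ.isTopGenerator_γK hγ x = 0 :=
    I.eq_zero_of_smul_eq_zero hγ hf (by rw [← map_smul, hfx, map_zero])
  have hcorA : Φ.IK.corOverTwist u hu' hu₁ I_A Φ.isTopGenerator_γK hγ x = 0 :=
    I_A.eq_zero_of_smul_eq_zero hγ hf (by rw [← map_smul, hfx, map_zero])
  -- the sum identity `res cor + res^A cor^A = 2`
  have hsum := Φ.IK.resOver_corOver_add_resOverTwist_corOverTwist u hu hu' hu₁ hu₂ I I_A hγ Φ.isTopGenerator_γK x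
  rw [hcor, hcorA, map_zero, map_zero, add_zero] at hsum
  exact KSideRank.eq_zero_of_two_nsmul_eq_zero (by decide) Φ.IK hsum.symm

/-- (tf) in Mathlib's currency: `Φ.IK.H` is a torsion-free `Λ`-module. [cite: Kato2004Asterisque, Thm. 12.4 (2) (p. 221)] -/
theorem isTorsionFree_IK (hγ : K.IsTopGenerator γ) : Module.IsTorsionFree (IwasawaAlgebra 7) Φ.IK.H := by
  haveI : NoZeroSMulDivisors (IwasawaAlgebra 7) Φ.IK.H :=
    ⟨fun {f x} h => or_iff_not_imp_left.mpr fun hf => Φ.tf_of_inputs hγ f x hf h⟩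
  infer_instance

/-! ## §4 (rk): `rank_{Λ_O} 𝐇′(S′_W) ≤ 1` — any `x, y, πy` are `Λ`-dependent — from GZK on `𝒞₇` -/

/-- **The algebraic core of (rk) on the frame**: if the ℚ-side pin `I` of `W` and SOME ℚ-side pin `I_A` of SOME model `A`
of `W^{(−7)}` carrying a twist isomorphism `u` have `Λ`-rank `≤ 1`, then any three elements of `Φ.IK.H` — in particular
`x, y, Φ.piK y` — satisfy a non-trivial `Λ`-relation (`(cor, cor^A)` is injective by the sum identity; rank–nullity over
the domain `Λ`). [cite: Kato2004Asterisque, Thm. 12.4 (2) (p. 221) and 15.14 (p. 264)] [cite: GreenbergLNM1716, §4 p. 107] -/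
theorem rk_of_rank_le_one (hγ : K.IsTopGenerator γ) {A : WeierstrassCurve ℚ} [A.IsElliptic]
    [ContinuousSMul ℤ_[7] (A.tateModule 7)] (u : A.tateModule 7 ≃ₗ[ℤ_[7]] W.tateModule 7) (hu : Continuous u)
    (hu' : Continuous u.symm)
    (hu₁ : ∀ σ : absoluteGaloisGroup ℚ, σ ∈ galRange (K := ℚ) Φ.Kcm → ∀ x : A.tateModule 7, u (σ • x) = σ • u x)
    (hu₂ : ∀ σ : absoluteGaloisGroup ℚ, σ ∉ galRange (K := ℚ) Φ.Kcm → ∀ x : A.tateModule 7, u (σ • x) = -(σ • u x))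
    (I_A : IwasawaH1Data A 7 K γ) (hI : Module.rank (IwasawaAlgebra 7) I.H ≤ 1)
    (hI_A : Module.rank (IwasawaAlgebra 7) I_A.H ≤ 1) (x y z : Φ.IK.H) :
    ∃ s r₀ r₁ : IwasawaAlgebra 7, (s ≠ 0 ∨ r₀ ≠ 0 ∨ r₁ ≠ 0) ∧ s • x = r₀ • y + r₁ • z := by
  haveI : (galRange (K := ℚ) Φ.Kcm).Normal := Φ.normal_galRange_Kcm
  refine KSideRank.exists_rel_of_rank_le_one (Φ.IK.corOver I Φ.isTopGenerator_γK hγ)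
    (Φ.IK.corOverTwist u hu' hu₁ I_A Φ.isTopGenerator_γK hγ) (fun w hw hwA => ?_) hI hI_A x y z
  have hsum := Φ.IK.resOver_corOver_add_resOverTwist_corOverTwist u hu hu' hu₁ hu₂ I I_A hγ Φ.isTopGenerator_γK w
  rw [hw, hwA, map_zero, map_zero, add_zero] at hsum
  exact KSideRank.eq_zero_of_two_nsmul_eq_zero (by decide) Φ.IK hsum.symm

omit [ContinuousSMul ℤ_[7] (W.tateModule 7)] in
/-- **(R1)+(R2) under GZK: the ℚ-side pin of a globally minimal `V/ℚ` of analytic rank `1` has `Λ`-rank `≤ 1`** —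
GZK gives Mordell–Weil rank `1` and `Ш(V)` finite, (R1) `LocPKummer.rank_integralH1_le_one` gives
`rank_{ℤ₇} H¹(ℤ[1/7], T₇V) ≤ 1`, (R2) `IwasawaH1Data.rank_le_one_of_rank_integralH1_le_one` concludes.
[cite: Darmon2004, Thm. 3.22 (= Thm. 1.14)] [cite: Kato2004Asterisque, Thm. 12.4 (2) (p. 221) and §14.9 (14.9.3) (p. 240)] -/
theorem rank_le_one_of_GZK (hGZK : rank_eq_analyticRank_of_analyticRank_le_one) (V : WeierstrassCurve ℚ) [V.IsElliptic]
    [V.IsGloballyMinimal] [ContinuousSMul ℤ_[7] (V.tateModule 7)] (hV : V.analyticRank = 1) (hKc : K.IsCyclotomic)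
    (hγ : K.IsTopGenerator γ) (J : IwasawaH1Data V 7 K γ) : Module.rank (IwasawaAlgebra 7) J.H ≤ 1 := by
  obtain ⟨hrank, hsha⟩ := hGZK V (by rw [hV])
  rw [hV] at hrank
  haveI : Finite V.sha := hsha
  have hsha7 : Finite (AddCommGroup.primaryComponent V.sha 7) := inferInstance
  exact IwasawaH1Data.rank_le_one_of_rank_integralH1_le_one hKc hγ J (LocPKummer.rank_integralH1_le_one V 7 K hrank hsha7)

/-- **★ (rk) — the binder (rk) of `stub_integralComparisonInputsSeven` is a THEOREM at every pinned frame of a member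
`W ∈ 𝒞₇`, given GZK**: any `x, y, Φ.piK y ∈ Φ.IK.H` satisfy `s • x = r₀ • y + r₁ • Φ.piK y` with `(s, r₀, r₁) ≠ 0`
(`rank_{Λ_O} 𝐇′(S′_W) ≤ 1`, Kato Thm. 12.4 (2) at the split hull).  Proof: `rk_of_rank_le_one` with the twist pair of §2;
`rank_Λ I.H ≤ 1` and `rank_Λ I_A.H ≤ 1` by `rank_le_one_of_GZK`, the latter because the globally minimal twist model `A`
has `analyticRank A = analyticRank W = 1` (`analyticRank_twistModel_eq`: `A ~ W` over `ℚ`).  ★ is not used.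
[cite: Kato2004Asterisque, Thm. 12.4 (2) (p. 221) and 15.14 (p. 264)] [cite: Darmon2004, Thm. 3.22 (= Thm. 1.14)]
[cite: Milne1972ArithmeticAV, Thm. 3 (through BurungaleFlach2024)] [cite: GreenbergLNM1716, §4 p. 107] -/
theorem rk_of_inputs (hGZK : rank_eq_analyticRank_of_analyticRank_le_one) (hC : X12.ClassCSeven W)
    (hγ : K.IsTopGenerator γ) :
    ∀ x y : Φ.IK.H, ∃ s r₀ r₁ : IwasawaAlgebra 7,
      (s ≠ 0 ∨ r₀ ≠ 0 ∨ r₁ ≠ 0) ∧ s • x = r₀ • y + r₁ • Φ.piK y := by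
  intro x y
  obtain ⟨A, hAell, hAmin, C, hA, u, hu, hu', hu₁, hu₂⟩ := Φ.exists_twistPair
  letI : ContinuousSMul ℤ_[7] (A.tateModule 7) := TateModule.continuousSMul_padicInt
  obtain ⟨I_A⟩ := nonempty_iwasawaH1Data_holds A 7 K γ hK hγ
  have hW1 : W.analyticRank = 1 := hC.2.2.1
  have hA1 : A.analyticRank = 1 := by rw [analyticRank_twistModel_eq hC.2.1 A C hA, hW1]
  exact Φ.rk_of_rank_le_one hγ u hu hu' hu₁ hu₂ I_A (rank_le_one_of_GZK hGZK W hW1 hK hγ I)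
    (rank_le_one_of_GZK hGZK A hA1 hK hγ I_A) x y (Φ.piK y)

/-- **(tf) ∧ (rk) together, in the letter of the stub's two conjuncts** (zp v13 l.510–513), at every pinned frame of a
member `W ∈ 𝒞₇` over a cyclotomic datum with topological generator `γ`, given GZK.  CONDITIONAL only on GZK (the stub's
own antecedent); nothing else asserted; 19945 stays OPEN.
[cite: Kato2004Asterisque, Thm. 12.4 (2) (p. 221) and 15.14 (p. 264)] [cite: Darmon2004, Thm. 3.22 (= Thm. 1.14)] -/
theorem tf_and_rk_of_inputs (hGZK : rank_eq_analyticRank_of_analyticRank_le_one) (hC : X12.ClassCSeven W)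
    (hγ : K.IsTopGenerator γ) :
    (∀ (f : IwasawaAlgebra 7) (x : Φ.IK.H), f ≠ 0 → f • x = 0 → x = 0) ∧
    (∀ x y : Φ.IK.H, ∃ s r₀ r₁ : IwasawaAlgebra 7,
      (s ≠ 0 ∨ r₀ ≠ 0 ∨ r₁ ≠ 0) ∧ s • x = r₀ • y + r₁ • Φ.piK y) :=
  ⟨Φ.tf_of_inputs hγ, Φ.rk_of_inputs hGZK hC hγ⟩

end PinnedKatoGenusFrame

end Frame

end Summit.BirchSwinnertonDyer.Rank1Residual.Additive.GenusSeven

end
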